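import Literature.Analysis.FluidPDE.BiotSavartRepresentationSqIntegrable
import Literature.Analysis.SingularIntegrals.HardyLittlewoodSobolevWeak
import HarnessLib

/-!
# The Biot–Savart representation `v(x) = (K₃ ∗ curl v)(x)` for fields VANISHING AT INFINITY, the
# pointwise Riesz-potential majorant `|v| ≤ (4π)⁻¹ I₁|curl v|`, and the endpoint weak-Lorentz bound
# `curl v ∈ L^{p,∞} ⟹ v ∈ L^{q,∞}`, `1/q = 1/p − 1/3` (e.g. `p = 9/5 ↦ q = 9/2`)

Analysis/FluidPDE proof file (theorems only; no definitions, no named facts). The tree has two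
Biot–Savart representation theorems: `biotSavart_curl_eq_self_holds` (Majda–Bertozzi Prop. 2.16:
`curl v ∈ L¹ ∩ L^∞`, `v → 0` at infinity) and `biotSavart_curl_eq_self_of_lintegral_sq_lt_top`
(`v, curl v ∈ L²`, no decay; `BiotSavartRepresentationSqIntegrable.lean`). Neither covers the
hypothesis set of the ENDPOINT steady Liouville problem — a smooth divergence-free `v` with
`v(x) → 0` as `|x| → ∞` and `curl v` in the weak Lebesgue space `L^{9/5,∞}(ℝ³)` (Wu 2026, Lemma 2.1:
«`v(x) = (1/4π)∫ ω(y) × (x − y)/|x − y|³ dy` (2.2) … `‖v‖_{L^{9/2,∞}} ≤ C‖ω‖_{L^{9/5,∞}}` (2.3)»), where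
`curl v` is neither integrable nor square integrable in general. This file proves:

* `biotSavart_curl_eq_self_of_tendsto_cocompact` — for `v ∈ C²` divergence free with
  `v → 0` along the cocompact filter, `(K₃ ∗ curl v)(x) = v(x)` at EVERY point `x` at which the
  Biot–Savart majorant `y ↦ ‖curl v(y)‖ |x − y|⁻²` is integrable. Proof: the tree's LOCAL HELMHOLTZ
  IDENTITY AT SCALE `ρ` (`eq_biotSavart_curl_suppCutoff_smul_add`:
  `v(x) = (K₃ ∗ curl(φ_ρ v))(x) + ∑ⱼ (∫ ∂ⱼΓ(x − y) ⟪v(y), ∇φ_ρ(y)⟫ dy) eⱼ`) and `ρ → ∞`, exactly as in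
  `biotSavart_curl_eq_self_of_lintegral_sq_lt_top`, with ONE change: the two shell terms (the
  `Dφ_ρ ⊗ v` part of `curl(φ_ρ v)` and the pressure-like sum) live on the shell `ρ ≤ |y − x| ≤ 2ρ`,
  where `‖Dφ_ρ‖ |x − y|⁻² ≤ B ρ⁻³` (`norm_fderiv_suppCutoff_le`) and the shell has volume
  `≤ 8|B₁|ρ³`, so both are `≤ const · sup_{|y − x| ≥ ρ} |v(y)|`, which tends to `0` because `v → 0` at
  infinity — no `L²` bound on `v` is needed; the main term `(K₃ ∗ φ_ρ ω)(x) → (K₃ ∗ ω)(x)` by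
  dominated convergence against `(4π)⁻¹‖ω(y)‖|x − y|⁻²`, integrable by hypothesis.
* `enorm_le_rieszPotential_curl` — under the same hypotheses, for EVERY `x`,
  `‖v(x)‖ₑ ≤ (4π)⁻¹ · I₁(‖curl v‖ₑ)(x)` with the tree's Riesz potential
  `rieszPotential volume 1 Φ x = ∫⁻ Φ(y) ‖x − y‖^{1−3} dy` (`HardyLittlewoodSobolev.lean`): where the
  potential is infinite the bound is trivial, where it is finite the previous theorem applies and
  `‖K₃(x − y)h‖ ≤ (4π)⁻¹‖h‖|x − y|⁻²` (`norm_biotSavartKernel_le`).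
* `memWeakLp_of_memWeakLp_curl` — for `1 < p < 3` and `q` with `q = 3p/(3 − p)`:
  `curl v ∈ L^{p,∞}(ℝ³) ⟹ v ∈ L^{q,∞}(ℝ³)`, with the explicit bound
  `sup_t t^q |{|v| > t}| ≤ C (4π)^{−q} (sup_s s^p |{|curl v| > s}|)^{3/(3−p)}` — the previous majorant
  fed into the tree's WEAK-TYPE Hardy–Littlewood–Sobolev inequality
  `meas_lt_rieszPotential_le_of_eWeakLpPow` (`HardyLittlewoodSobolevWeak.lean`, `α = 1`, `n = 3`);
  `memWeakLp_nine_halves_of_memWeakLp_curl` is the instance `p = 9/5 ↦ q = 9/2` of Wu's (2.3).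

No Liouville theorem, no Weyl lemma and no ball averages are used: Wu's printed route (p.6 l.49–62:
Biot–Savart + weak HLS for `K₃ ∗ ω`, then harmonicity and decay of ball averages of `v − K₃ ∗ ω`) is
replaced by the tree's local Helmholtz identity, which gives the representation directly.

## Mathlib / tree search

Tree (used): `eq_biotSavart_curl_suppCutoff_smul_add`, `biotSavart_curl_eq_self_of_lintegral_sq_lt_top`
(pattern) (`BiotSavartRepresentationSqIntegrable`); `norm_fderiv_suppCutoff_le`,
`fderiv_suppCutoff_eq_zero`, `fderiv_suppCutoff_eq_zero_of_lt`, `suppCutoff_eq_one`,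
`abs_suppCutoff_le_one`, `contDiff_suppCutoff`, `hasCompactSupport_suppCutoff`,
`exists_norm_fderiv_radialCutoff_le` (`SingularKernelGradient/Holder/Truncation`); `curl_smul`,
`continuous_curl`, `hasCompactSupport_curl`, `curlCLM` (`VorticityCalculus`); `norm_biotSavartKernel_le`
(`BiotSavartBounds`); `measurable_biotSavartKernel_sub_apply` (`BiotSavartIntegral`);
`integrable_biotSavartKernel_sub_apply_of_hasCompactSupport` (`LocalHelmholtzSupBound`);
`norm_fderiv_newtonKernel_le` (`BiotSavartNewtonKernel`); `rieszPotential`,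
`meas_lt_rieszPotential_le_of_eWeakLpPow` (`SingularIntegrals`); `eWeakLpPow`, `MemWeakLp`
(`FunctionSpaces/WeakLp`). `lean search 'biotSavart_curl_eq_self|cocompact.*biotSavart'` (2026-08-27):
no representation theorem under decay + weak-`L^p` vorticity before this file. Mathlib:
`tendsto_integral_of_dominated_convergence`, `Measure.addHaar_closedBall`, `Metric.cobounded_eq_cocompact`,
`comap_norm_atTop`, `tendsto_nhds_unique`.

## References

* W. Wu, *The Global Weak-Lorentz Vorticity Endpoint in the Stationary Navier–Stokes Liouville
  Problem*, arXiv:2608.22471v1 (2026), Lemma 2.1 (2.2)–(2.3), p.5 l.30 – p.6 l.62. [Wu2026]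
* A. J. Majda, A. L. Bertozzi, *Vorticity and Incompressible Flow* (CUP 2002), §2.4.1 Prop. 2.16,
  (2.92)–(2.95). [MajdaBertozziCUP2002]
* E. M. Stein, *Singular integrals and differentiability properties of functions* (1970), Ch. V
  §1.2 Thm 1, §1.4. [Stein1971]

WHAT THIS IS NOT: not a claim about NS regularity or blow-up; not a claim about any author beyond the
typed locator.
-/

noncomputable section

open MeasureTheory Set Function Filter Metric Real InnerProductSpace
open _root_.Topology
open scoped ENNReal NNReal RealInnerProductSpace Laplacian ContDiff

namespace Literature.Analysis.FluidPDE

open Literature.Analysis.SingularIntegrals Literature.Analysis.FunctionSpaces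

/-! ### Tools: the shell majorant at scale `ρ` and the sup bound on the shell -/

section Tools

/-- The shell `ρ ≤ |y − x| ≤ 2ρ` as a set: `B̄(x, 2ρ) ∖ B(x, ρ)`. [folklore] -/
private theorem mem_shell_iff (x y : EuclideanSpace ℝ (Fin 3)) (ρ : ℝ) :
    y ∈ closedBall x (2 * ρ) ∩ (ball x ρ)ᶜ ↔ ‖y - x‖ ≤ 2 * ρ ∧ ρ ≤ ‖y - x‖ := by
  rw [mem_inter_iff, mem_compl_iff, mem_closedBall, mem_ball, dist_eq_norm, not_lt]

/-- **The shell majorant.** With the universal cutoff constant `B`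
(`‖D(radialCutoff ε 2ε)‖ ≤ B ε⁻¹`): for `ρ > 0` and all `y`,
`‖Dφ_ρ(y)‖ · |x − y|⁻² ≤ B ρ⁻³ · 1_{B̄(x, 2ρ) ∖ B(x, ρ)}(y)` — the derivative of `φ_ρ = suppCutoff x ρ`
lives on the shell `ρ ≤ |y − x| ≤ 2ρ`, where `|x − y|⁻² ≤ ρ⁻²`. [folklore] -/
private theorem norm_fderiv_suppCutoff_mul_inv_sq_le_shell {B : ℝ}
    (hB : ∀ ε : ℝ, 0 < ε → ∀ z : EuclideanSpace ℝ (Fin 3),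
      ‖fderiv ℝ (radialCutoff ε (2 * ε)) z‖ ≤ B * ε⁻¹)
    (hB0 : 0 ≤ B) (x : EuclideanSpace ℝ (Fin 3)) {ρ : ℝ} (hρ : 0 < ρ) (y : EuclideanSpace ℝ (Fin 3)) :
    ‖fderiv ℝ (suppCutoff x ρ) y‖ * (‖x - y‖ ^ 2)⁻¹ ≤
      B * (ρ ^ 3)⁻¹ * (closedBall x (2 * ρ) ∩ (ball x ρ)ᶜ).indicator (fun _ => (1 : ℝ)) y := by
  have hind0 : 0 ≤ (closedBall x (2 * ρ) ∩ (ball x ρ)ᶜ).indicator (fun _ => (1 : ℝ)) y :=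
    indicator_nonneg (fun _ _ => zero_le_one) y
  by_cases h1 : ‖y - x‖ < ρ
  · rw [fderiv_suppCutoff_eq_zero hρ h1, norm_zero, zero_mul]
    positivity
  by_cases h2 : 2 * ρ < ‖y - x‖
  · rw [fderiv_suppCutoff_eq_zero_of_lt hρ h2, norm_zero, zero_mul]
    positivity
  · have hy2 : y ∈ closedBall x (2 * ρ) ∩ (ball x ρ)ᶜ := by
      rw [mem_shell_iff]
      exact ⟨not_lt.1 h2, not_lt.1 h1⟩
    rw [indicator_of_mem hy2, mul_one]
    have hxy : ρ ≤ ‖x - y‖ := by rw [norm_sub_rev]; exact not_lt.1 h1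
    have hinv : (‖x - y‖ ^ 2)⁻¹ ≤ (ρ ^ 2)⁻¹ := by
      refine inv_anti₀ (by positivity) ?_
      exact pow_le_pow_left₀ hρ.le hxy 2
    calc ‖fderiv ℝ (suppCutoff x ρ) y‖ * (‖x - y‖ ^ 2)⁻¹ ≤ (B * ρ⁻¹) * (ρ ^ 2)⁻¹ :=
          mul_le_mul (norm_fderiv_suppCutoff_le hB x hρ y) hinv (by positivity) (by positivity)
      _ = B * (ρ ^ 3)⁻¹ := by
          field_simp

/-- **Sup bound for the mass of `v` on the shell, after the `ρ⁻³` weight**: if `‖v(y)‖ ≤ ε` whenever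
`|y − x| ≥ ρ`, then `ρ⁻³ ∫ 1_{B̄(x,2ρ) ∖ B(x,ρ)} ‖v‖ ≤ 8|B₁| ε` (`|B̄(x, 2ρ)| = (2ρ)³|B₁|`,
`Measure.addHaar_closedBall`). [folklore] -/
private theorem inv_cube_mul_integral_shell_norm_le
    {v : EuclideanSpace ℝ (Fin 3) → EuclideanSpace ℝ (Fin 3)} (hvc : Continuous v)
    (x : EuclideanSpace ℝ (Fin 3)) {ρ ε : ℝ} (hρ : 0 < ρ) (hε : 0 ≤ ε)
    (hv : ∀ y, ρ ≤ ‖y - x‖ → ‖v y‖ ≤ ε) :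
    Integrable (fun y => (closedBall x (2 * ρ) ∩ (ball x ρ)ᶜ).indicator (fun _ => (1 : ℝ)) y * ‖v y‖) ∧
      (ρ ^ 3)⁻¹ * ∫ y, (closedBall x (2 * ρ) ∩ (ball x ρ)ᶜ).indicator (fun _ => (1 : ℝ)) y * ‖v y‖ ≤
        8 * (volume (ball (0 : EuclideanSpace ℝ (Fin 3)) 1)).toReal * ε := by
  set S : Set (EuclideanSpace ℝ (Fin 3)) := closedBall x (2 * ρ) ∩ (ball x ρ)ᶜ with hSdef
  have hSm : MeasurableSet S := measurableSet_closedBall.inter measurableSet_ball.compl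
  set V₁ : ℝ := (volume (ball (0 : EuclideanSpace ℝ (Fin 3)) 1)).toReal with hV₁
  have hV₁0 : 0 ≤ V₁ := ENNReal.toReal_nonneg
  set χ : EuclideanSpace ℝ (Fin 3) → ℝ := (closedBall x (2 * ρ)).indicator (fun _ => (1 : ℝ)) with hχ
  have hχi : Integrable χ := by
    rw [hχ, integrable_indicator_iff measurableSet_closedBall]
    exact integrableOn_const measure_closedBall_lt_top.ne
  -- integrability of the shell mass
  have hint : Integrable (fun y => S.indicator (fun _ => (1 : ℝ)) y * ‖v y‖) := by
    have h1 : Integrable (S.indicator fun y => ‖v y‖) := by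
      rw [integrable_indicator_iff hSm]
      exact (hvc.norm.continuousOn.integrableOn_compact (isCompact_closedBall x (2 * ρ))).mono_set
        inter_subset_left
    refine h1.congr (Eventually.of_forall fun y => ?_)
    by_cases hy : y ∈ S
    · simp only [indicator_of_mem hy, one_mul]
    · simp only [indicator_of_notMem hy, zero_mul]
  refine ⟨hint, ?_⟩
  -- pointwise: `1_S ‖v‖ ≤ ε 1_{B̄(x, 2ρ)}`
  have hpt : ∀ y, S.indicator (fun _ => (1 : ℝ)) y * ‖v y‖ ≤ ε * χ y := by
    intro y
    by_cases hy : y ∈ S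
    · have hy' : y ∈ closedBall x (2 * ρ) := hy.1
      rw [indicator_of_mem hy, one_mul, hχ, indicator_of_mem hy', mul_one]
      exact hv y ((mem_shell_iff x y ρ).1 hy).2
    · rw [indicator_of_notMem hy, zero_mul]
      exact mul_nonneg hε (indicator_nonneg (fun _ _ => zero_le_one) y)
  have hvol : ∫ y, χ y = (2 * ρ) ^ 3 * V₁ := by
    rw [hχ, integral_indicator_const _ measurableSet_closedBall, smul_eq_mul, mul_one,
      measureReal_def, Measure.addHaar_closedBall _ _ (by positivity), ENNReal.toReal_mul,
      finrank_euclideanSpace_fin, ENNReal.toReal_ofReal (by positivity)]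
  have hI : ∫ y, S.indicator (fun _ => (1 : ℝ)) y * ‖v y‖ ≤ ε * ((2 * ρ) ^ 3 * V₁) := by
    calc ∫ y, S.indicator (fun _ => (1 : ℝ)) y * ‖v y‖ ≤ ∫ y, ε * χ y :=
          integral_mono hint (hχi.const_mul ε) hpt
      _ = ε * ((2 * ρ) ^ 3 * V₁) := by rw [integral_const_mul, hvol]
  have hρ3 : 0 < ρ ^ 3 := by positivity
  calc (ρ ^ 3)⁻¹ * ∫ y, S.indicator (fun _ => (1 : ℝ)) y * ‖v y‖
      ≤ (ρ ^ 3)⁻¹ * (ε * ((2 * ρ) ^ 3 * V₁)) := mul_le_mul_of_nonneg_left hI (by positivity)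
    _ = 8 * V₁ * ε := by
        field_simp
        ring

/-- From `v → 0` along the cocompact filter of `ℝ³`: for every `ε > 0` there is a radius `r` with
`‖v(y)‖ < ε` for `‖y‖ > r` (`cocompact = cobounded = comap ‖·‖ atTop`). [folklore] -/
private theorem exists_radius_norm_lt_of_tendsto_cocompact
    {v : EuclideanSpace ℝ (Fin 3) → EuclideanSpace ℝ (Fin 3)}
    (hdec : Tendsto v (cocompact (EuclideanSpace ℝ (Fin 3))) (𝓝 0)) {ε : ℝ} (hε : 0 < ε) :
    ∃ r : ℝ, ∀ y, r < ‖y‖ → ‖v y‖ < ε := by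
  have h := (Metric.tendsto_nhds.1 hdec) ε hε
  rw [← Metric.cobounded_eq_cocompact, ← comap_norm_atTop, eventually_comap, eventually_atTop] at h
  obtain ⟨r, hr⟩ := h
  refine ⟨r, fun y hy => ?_⟩
  have := hr ‖y‖ hy.le y rfl
  simpa [dist_zero_right] using this

end Tools

/-! ### The representation theorem under decay -/

section Main

variable {v : (EuclideanSpace ℝ (Fin 3)) → (EuclideanSpace ℝ (Fin 3))}

/-- **Biot–Savart representation for fields vanishing at infinity, at a point of finite majorant.**
Let `v ∈ C²(ℝ³; ℝ³)` be divergence free with `v → 0` at infinity, and let `x` be a point where the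
Biot–Savart majorant of `ω = curl v` is finite, `∫ ‖ω(y)‖ |x − y|⁻² dy < ∞`. Then
`(K₃ ∗ ω)(x) = v(x)` — no integrability of `ω`, no `L²` bound on `v` (compare
`biotSavart_curl_eq_self_holds`: `ω ∈ L¹ ∩ L^∞`; `biotSavart_curl_eq_self_of_lintegral_sq_lt_top`:
`v, ω ∈ L²`). Proof: in the scale-`ρ` local Helmholtz identity
`eq_biotSavart_curl_suppCutoff_smul_add`, `curl(φ_ρ v) = φ_ρ ω + Dφ_ρ ⊗ v` (`curl_smul`); the cutoff
term of the Biot–Savart integral and the pressure-like sum are both bounded by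
`(4π)⁻¹ B ρ⁻³ ∫_{ρ ≤ |y−x| ≤ 2ρ}‖v‖ ≤ (4π)⁻¹ B · 8|B₁| · sup_{|y−x| ≥ ρ}‖v(y)‖ → 0`
(`norm_fderiv_suppCutoff_mul_inv_sq_le_shell`, `inv_cube_mul_integral_shell_norm_le`, `v → 0`), while
`(K₃ ∗ φ_ρ ω)(x) → (K₃ ∗ ω)(x)` by dominated convergence (integrand eventually constant in `ρ`,
dominated by `(4π)⁻¹‖ω‖|x − ·|⁻² ∈ L¹` by hypothesis); the constant sequence `v(x)` therefore tends
to `(K₃ ∗ ω)(x)`. This is Wu's (2.2) «`v(x) = (1/4π)∫ ω(y) × (x − y)/|x − y|³ dy`» with the printed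
harmonic-remainder/Liouville step (p.6 l.49–62) replaced by the tree's local identity.
[cite: Wu2026, Lemma 2.1 (2.2) p.5 l.37–40, proof p.6 l.1–62] [cite: MajdaBertozziCUP2002, §2.4.1 Prop. 2.16 (2.92)–(2.95)] -/
theorem biotSavart_curl_eq_self_of_tendsto_cocompact (hv : ContDiff ℝ 2 v)
    (hdiv : VectorCalculus.IsDivFree v)
    (hdec : Tendsto v (cocompact (EuclideanSpace ℝ (Fin 3))) (𝓝 0)) {x : EuclideanSpace ℝ (Fin 3)}
    (hint : Integrable fun y => ‖curl v y‖ * (‖x - y‖ ^ 2)⁻¹) :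
    biotSavart (curl v) x = v x := by
  obtain ⟨B, hB0, hB⟩ := exists_norm_fderiv_radialCutoff_le
  have hv1 : ContDiff ℝ 1 v := hv.of_le (by norm_num)
  have hvc : Continuous v := hv.continuous
  have hvd : Differentiable ℝ v := hv1.differentiable one_ne_zero
  set w : EuclideanSpace ℝ (Fin 3) → EuclideanSpace ℝ (Fin 3) := curl v with hwdef
  have hωc : Continuous w := continuous_curl hv1
  set V₁ : ℝ := (volume (ball (0 : EuclideanSpace ℝ (Fin 3)) 1)).toReal with hV₁
  have hV₁0 : 0 ≤ V₁ := ENNReal.toReal_nonneg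
  -- the constant in front of the sup on the shell
  set A : ℝ := (4 * π)⁻¹ * B * (8 * V₁) with hA
  have hA0 : 0 ≤ A := by positivity
  -- the scale of the `n`-th cutoff
  set ρ : ℕ → ℝ := fun n => (n : ℝ) + 1 with hρdef
  have hρ0 : ∀ n, 0 < ρ n := fun n => by rw [hρdef]; positivity
  -- the cutoffs
  set φ : ℕ → EuclideanSpace ℝ (Fin 3) → ℝ := fun n => suppCutoff x (ρ n) with hφdef
  have hφ1 : ∀ n, ContDiff ℝ 1 (φ n) := fun n => contDiff_suppCutoff x (ρ n) (n := 1)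
  have hφd : ∀ n, Differentiable ℝ (φ n) := fun n => (hφ1 n).differentiable one_ne_zero
  have hφc : ∀ n, HasCompactSupport (φ n) := fun n => hasCompactSupport_suppCutoff x (hρ0 n)
  -- the three sequences: main Biot–Savart term, cutoff remainder, pressure-like sum
  set main : ℕ → EuclideanSpace ℝ (Fin 3) := fun n =>
    ∫ y, biotSavartKernel (x - y) (φ n y • w y) with hmain
  set rem : ℕ → EuclideanSpace ℝ (Fin 3) := fun n =>
    ∫ y, biotSavartKernel (x - y) (curlCLM ((fderiv ℝ (φ n) y).smulRight (v y))) with hrem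
  set prs : ℕ → EuclideanSpace ℝ (Fin 3) := fun n =>
    ∑ j, (∫ y, fderiv ℝ newtonKernel (x - y) (EuclideanSpace.single (j : Fin 3) (1 : ℝ)) *
      ⟪v y, gradient (φ n) y⟫) • (EuclideanSpace.single (j : Fin 3) (1 : ℝ)) with hprs
  -- (1) the identity at every scale: `v x = main n + rem n + prs n`
  have hid : ∀ n, v x = main n + rem n + prs n := by
    intro n
    have h := eq_biotSavart_curl_suppCutoff_smul_add hv hdiv (hρ0 n) x
    -- split the curl of the localised field
    have hsplit : ∀ y, curl (fun y => φ n y • v y) y =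
        φ n y • w y + curlCLM ((fderiv ℝ (φ n) y).smulRight (v y)) := fun y =>
      curl_smul ((hφd n) y) (hvd y)
    have hs₁c : Continuous fun y => φ n y • w y := (hφ1 n).continuous.smul hωc
    have hs₁s : HasCompactSupport fun y => φ n y • w y := (hφc n).smul_right
    -- the remainder is `curl(φ v) − φ ω`: continuous with compact support
    have hrem_eq : (fun y => curlCLM ((fderiv ℝ (φ n) y).smulRight (v y))) =
        fun y => curl (fun y => φ n y • v y) y - φ n y • w y := by
      funext y
      rw [hsplit y, add_sub_cancel_left]
    have hWs : HasCompactSupport ((φ n) • v) := (hφc n).smul_right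
    have hs₂c : Continuous fun y => curlCLM ((fderiv ℝ (φ n) y).smulRight (v y)) := by
      rw [hrem_eq]
      exact (continuous_curl ((hφ1 n).smul hv1)).sub hs₁c
    have hs₂s : HasCompactSupport fun y => curlCLM ((fderiv ℝ (φ n) y).smulRight (v y)) := by
      rw [hrem_eq]
      exact (hasCompactSupport_curl hWs).sub hs₁s
    have I₁ := integrable_biotSavartKernel_sub_apply_of_hasCompactSupport hs₁c hs₁s x
    have I₂ := integrable_biotSavartKernel_sub_apply_of_hasCompactSupport hs₂c hs₂s x
    have hBS : biotSavart (curl fun y => φ n y • v y) x = main n + rem n := by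
      rw [biotSavart, hmain, hrem, ← integral_add I₁ I₂]
      refine integral_congr_ae (Eventually.of_forall fun y => ?_)
      show biotSavartKernel (x - y) (curl (fun y => φ n y • v y) y) =
        biotSavartKernel (x - y) (φ n y • w y) +
          biotSavartKernel (x - y) (curlCLM ((fderiv ℝ (φ n) y).smulRight (v y)))
      rw [← biotSavartCLM_apply, ← biotSavartCLM_apply, ← biotSavartCLM_apply, hsplit, map_add]
    rw [h, hBS]
  -- (2) the shell majorant
  have hshell : ∀ n y, ‖fderiv ℝ (φ n) y‖ * (‖x - y‖ ^ 2)⁻¹ ≤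
      B * (ρ n ^ 3)⁻¹ * (closedBall x (2 * ρ n) ∩ (ball x (ρ n))ᶜ).indicator (fun _ => (1 : ℝ)) y :=
    fun n y => norm_fderiv_suppCutoff_mul_inv_sq_le_shell hB hB0 x (hρ0 n) y
  -- (3) both small terms are `≤ const · ε` once `‖v‖ ≤ ε` outside `B(x, ρ n)`
  have hsmall : ∀ n (ε : ℝ), 0 ≤ ε → (∀ y, ρ n ≤ ‖y - x‖ → ‖v y‖ ≤ ε) →
      ‖rem n‖ ≤ ‖curlCLM‖ * A * ε ∧ ‖prs n‖ ≤ 3 * A * ε := by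
    intro n ε hε hvε
    obtain ⟨hgi, hgle⟩ := inv_cube_mul_integral_shell_norm_le hvc x (hρ0 n) hε hvε
    set χ : EuclideanSpace ℝ (Fin 3) → ℝ :=
      (closedBall x (2 * ρ n) ∩ (ball x (ρ n))ᶜ).indicator (fun _ => (1 : ℝ)) with hχdef
    constructor
    · -- the cutoff remainder of the Biot–Savart integral
      set g : EuclideanSpace ℝ (Fin 3) → ℝ := fun y => (4 * π)⁻¹ * ‖curlCLM‖ * B * (ρ n ^ 3)⁻¹ *
        (χ y * ‖v y‖) with hgdef
      have hgint : Integrable g := hgi.const_mul _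
      have hpt : ∀ y, ‖biotSavartKernel (x - y) (curlCLM ((fderiv ℝ (φ n) y).smulRight (v y)))‖ ≤
          g y := by
        intro y
        calc ‖biotSavartKernel (x - y) (curlCLM ((fderiv ℝ (φ n) y).smulRight (v y)))‖
            ≤ (4 * π)⁻¹ * ‖curlCLM ((fderiv ℝ (φ n) y).smulRight (v y))‖ * (‖x - y‖ ^ 2)⁻¹ :=
              norm_biotSavartKernel_le _ _
          _ ≤ (4 * π)⁻¹ * (‖curlCLM‖ * (‖fderiv ℝ (φ n) y‖ * ‖v y‖)) * (‖x - y‖ ^ 2)⁻¹ := by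
              gcongr
              calc ‖curlCLM ((fderiv ℝ (φ n) y).smulRight (v y))‖
                  ≤ ‖curlCLM‖ * ‖(fderiv ℝ (φ n) y).smulRight (v y)‖ :=
                    ContinuousLinearMap.le_opNorm _ _
                _ = ‖curlCLM‖ * (‖fderiv ℝ (φ n) y‖ * ‖v y‖) := by
                    rw [ContinuousLinearMap.norm_smulRight_apply]
          _ = (4 * π)⁻¹ * ‖curlCLM‖ * ((‖fderiv ℝ (φ n) y‖ * (‖x - y‖ ^ 2)⁻¹) * ‖v y‖) := by ring
          _ ≤ (4 * π)⁻¹ * ‖curlCLM‖ * ((B * (ρ n ^ 3)⁻¹ * χ y) * ‖v y‖) :=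
              mul_le_mul_of_nonneg_left (mul_le_mul_of_nonneg_right (hshell n y) (norm_nonneg _))
                (by positivity)
          _ = g y := by rw [hgdef]; ring
      refine (norm_integral_le_of_norm_le hgint (Eventually.of_forall hpt)).trans ?_
      rw [hgdef, integral_const_mul]
      calc (4 * π)⁻¹ * ‖curlCLM‖ * B * (ρ n ^ 3)⁻¹ * ∫ y, χ y * ‖v y‖
          = (4 * π)⁻¹ * ‖curlCLM‖ * B * ((ρ n ^ 3)⁻¹ * ∫ y, χ y * ‖v y‖) := by ring
        _ ≤ (4 * π)⁻¹ * ‖curlCLM‖ * B * (8 * V₁ * ε) :=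
            mul_le_mul_of_nonneg_left hgle (by positivity)
        _ = ‖curlCLM‖ * A * ε := by rw [hA]; ring
    · -- the pressure-like sum
      have he1 : ∀ j : Fin 3, ‖(EuclideanSpace.single (j : Fin 3) (1 : ℝ))‖ = 1 := fun j => by simp
      set g : EuclideanSpace ℝ (Fin 3) → ℝ := fun y => (4 * π)⁻¹ * B * (ρ n ^ 3)⁻¹ *
        (χ y * ‖v y‖) with hgdef
      have hgint : Integrable g := hgi.const_mul _
      have hgI : ∫ y, g y ≤ A * ε := by
        rw [hgdef, integral_const_mul]
        calc (4 * π)⁻¹ * B * (ρ n ^ 3)⁻¹ * ∫ y, χ y * ‖v y‖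
            = (4 * π)⁻¹ * B * ((ρ n ^ 3)⁻¹ * ∫ y, χ y * ‖v y‖) := by ring
          _ ≤ (4 * π)⁻¹ * B * (8 * V₁ * ε) := mul_le_mul_of_nonneg_left hgle (by positivity)
          _ = A * ε := by rw [hA]; ring
      have hcoef : ∀ j : Fin 3,
          |∫ y, fderiv ℝ newtonKernel (x - y) (EuclideanSpace.single (j : Fin 3) (1 : ℝ)) *
            ⟪v y, gradient (φ n) y⟫| ≤ A * ε := by
        intro j
        have hpt : ∀ y, ‖fderiv ℝ newtonKernel (x - y) (EuclideanSpace.single (j : Fin 3) (1 : ℝ)) *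
            ⟪v y, gradient (φ n) y⟫‖ ≤ g y := by
          intro y
          rw [norm_mul, Real.norm_eq_abs, Real.norm_eq_abs]
          have h1 : |fderiv ℝ newtonKernel (x - y) (EuclideanSpace.single (j : Fin 3) (1 : ℝ))| ≤
              (4 * π * ‖x - y‖ ^ 2)⁻¹ := by
            calc |fderiv ℝ newtonKernel (x - y) (EuclideanSpace.single (j : Fin 3) (1 : ℝ))|
                = ‖fderiv ℝ newtonKernel (x - y) (EuclideanSpace.single (j : Fin 3) (1 : ℝ))‖ :=
                  (Real.norm_eq_abs _).symm
              _ ≤ ‖fderiv ℝ newtonKernel (x - y)‖ *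
                    ‖(EuclideanSpace.single (j : Fin 3) (1 : ℝ))‖ := ContinuousLinearMap.le_opNorm _ _
              _ ≤ (4 * π * ‖x - y‖ ^ 2)⁻¹ * 1 := by
                  gcongr
                  · exact norm_fderiv_newtonKernel_le _
                  · rw [he1 j]
              _ = (4 * π * ‖x - y‖ ^ 2)⁻¹ := mul_one _
          have h2 : |⟪v y, gradient (φ n) y⟫| ≤ ‖v y‖ * ‖fderiv ℝ (φ n) y‖ := by
            calc |⟪v y, gradient (φ n) y⟫| ≤ ‖v y‖ * ‖gradient (φ n) y‖ := abs_real_inner_le_norm _ _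
              _ = ‖v y‖ * ‖fderiv ℝ (φ n) y‖ := by
                  rw [gradient, LinearIsometryEquiv.norm_map]
          calc |fderiv ℝ newtonKernel (x - y) (EuclideanSpace.single (j : Fin 3) (1 : ℝ))| *
                |⟪v y, gradient (φ n) y⟫|
              ≤ (4 * π * ‖x - y‖ ^ 2)⁻¹ * (‖v y‖ * ‖fderiv ℝ (φ n) y‖) :=
                mul_le_mul h1 h2 (abs_nonneg _) (by positivity)
            _ = (4 * π)⁻¹ * ((‖fderiv ℝ (φ n) y‖ * (‖x - y‖ ^ 2)⁻¹) * ‖v y‖) := by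
                rw [mul_inv]; ring
            _ ≤ (4 * π)⁻¹ * ((B * (ρ n ^ 3)⁻¹ * χ y) * ‖v y‖) :=
                mul_le_mul_of_nonneg_left (mul_le_mul_of_nonneg_right (hshell n y) (norm_nonneg _))
                  (by positivity)
            _ = g y := by rw [hgdef]; ring
        have h := norm_integral_le_of_norm_le hgint (Eventually.of_forall hpt)
        rw [Real.norm_eq_abs] at h
        exact h.trans hgI
      calc ‖prs n‖ ≤ ∑ j, ‖(∫ y, fderiv ℝ newtonKernel (x - y) (EuclideanSpace.single (j : Fin 3) (1 : ℝ)) *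
            ⟪v y, gradient (φ n) y⟫) • (EuclideanSpace.single (j : Fin 3) (1 : ℝ))‖ := norm_sum_le _ _
        _ = ∑ j, |∫ y, fderiv ℝ newtonKernel (x - y) (EuclideanSpace.single (j : Fin 3) (1 : ℝ)) *
            ⟪v y, gradient (φ n) y⟫| := by
            refine Finset.sum_congr rfl fun j _ => ?_
            rw [norm_smul, Real.norm_eq_abs, he1 j, mul_one]
        _ ≤ ∑ _j : Fin 3, A * ε := Finset.sum_le_sum fun j _ => hcoef j
        _ = 3 * A * ε := by
            rw [Finset.sum_const, Finset.card_univ, Fintype.card_fin]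
            simp
            ring
  -- (4) the two small terms tend to `0`, because `v → 0` at infinity
  have htail : ∀ ε : ℝ, 0 < ε → ∀ᶠ n in atTop, ∀ y, ρ n ≤ ‖y - x‖ → ‖v y‖ ≤ ε := by
    intro ε hε
    obtain ⟨r, hr⟩ := exists_radius_norm_lt_of_tendsto_cocompact hdec hε
    obtain ⟨N, hN⟩ := exists_nat_gt (r + ‖x‖)
    refine eventually_atTop.2 ⟨N, fun n hn y hy => ?_⟩
    have hρN : r + ‖x‖ < ρ n := by
      calc r + ‖x‖ < (N : ℝ) := hN
        _ ≤ (n : ℝ) := by exact_mod_cast hn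
        _ ≤ ρ n := by show (n : ℝ) ≤ (n : ℝ) + 1; linarith
    have hy' : r < ‖y‖ := by
      have : ‖y - x‖ ≤ ‖y‖ + ‖x‖ := norm_sub_le y x
      linarith
    exact (hr y hy').le
  have hK : ∀ (K : ℝ), 0 ≤ K → ∀ (s : ℕ → EuclideanSpace ℝ (Fin 3)),
      (∀ n (ε : ℝ), 0 ≤ ε → (∀ y, ρ n ≤ ‖y - x‖ → ‖v y‖ ≤ ε) → ‖s n‖ ≤ K * ε) →
      Tendsto s atTop (𝓝 0) := by
    intro K hK0 s hs
    rw [NormedAddGroup.tendsto_nhds_zero]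
    intro ε hε
    have hε' : 0 < ε / (K + 1) := div_pos hε (by linarith)
    filter_upwards [htail (ε / (K + 1)) hε'] with n hn
    calc ‖s n‖ ≤ K * (ε / (K + 1)) := hs n _ hε'.le hn
      _ < ε := by
          rw [mul_div_assoc']
          rw [div_lt_iff₀ (by linarith)]
          nlinarith
  have hrem0 : Tendsto rem atTop (𝓝 0) :=
    hK (‖curlCLM‖ * A) (by positivity) rem fun n ε hε hvε => (hsmall n ε hε hvε).1
  have hprs0 : Tendsto prs atTop (𝓝 0) :=
    hK (3 * A) (by positivity) prs fun n ε hε hvε => (hsmall n ε hε hvε).2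
  -- (5) the main term tends to `biotSavart w x` (dominated convergence)
  have hdom : Integrable fun y => (4 * π)⁻¹ * ‖w y‖ * (‖x - y‖ ^ 2)⁻¹ := by
    have h := hint.const_mul (4 * π)⁻¹
    refine h.congr (Eventually.of_forall fun y => ?_)
    show (4 * π)⁻¹ * (‖curl v y‖ * (‖x - y‖ ^ 2)⁻¹) = (4 * π)⁻¹ * ‖w y‖ * (‖x - y‖ ^ 2)⁻¹
    rw [hwdef, mul_assoc]
  have hmain : Tendsto main atTop (𝓝 (biotSavart w x)) := by
    rw [biotSavart]
    refine tendsto_integral_of_dominated_convergence (fun y => (4 * π)⁻¹ * ‖w y‖ * (‖x - y‖ ^ 2)⁻¹)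
      (fun n => ?_) hdom (fun n => Eventually.of_forall fun y => ?_)
      (Eventually.of_forall fun y => ?_)
    · -- measurability
      exact (measurable_biotSavartKernel_sub_apply
        (((hφ1 n).continuous.smul hωc).measurable) x).aestronglyMeasurable
    · -- domination: `|φ| ≤ 1`
      calc ‖biotSavartKernel (x - y) (φ n y • w y)‖
          ≤ (4 * π)⁻¹ * ‖φ n y • w y‖ * (‖x - y‖ ^ 2)⁻¹ := norm_biotSavartKernel_le _ _
        _ ≤ (4 * π)⁻¹ * ‖w y‖ * (‖x - y‖ ^ 2)⁻¹ := by
            gcongr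
            rw [norm_smul, Real.norm_eq_abs]
            exact mul_le_of_le_one_left (norm_nonneg _) (abs_suppCutoff_le_one x (ρ n) y)
    · -- pointwise: the integrand is eventually constant (`φ n y = 1` once `ρ n ≥ ‖y - x‖`)
      refine tendsto_const_nhds.congr' ?_
      obtain ⟨N, hN⟩ := exists_nat_ge ‖y - x‖
      refine eventually_atTop.2 ⟨N, fun n hn => ?_⟩
      have hle : ‖y - x‖ ≤ ρ n := by
        calc ‖y - x‖ ≤ (N : ℝ) := hN
          _ ≤ (n : ℝ) := by exact_mod_cast hn
          _ ≤ ρ n := by show (n : ℝ) ≤ (n : ℝ) + 1; linarith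
      show biotSavartKernel (x - y) (w y) = biotSavartKernel (x - y) (φ n y • w y)
      rw [hφdef]
      simp only [suppCutoff_eq_one (hρ0 n) hle, one_smul]
  -- (6) conclude: the constant sequence `v x` tends to `biotSavart w x + 0 + 0`
  have hsum : Tendsto (fun n => main n + rem n + prs n) atTop (𝓝 (biotSavart w x + 0 + 0)) :=
    (hmain.add hrem0).add hprs0
  rw [add_zero, add_zero] at hsum
  have hconst : Tendsto (fun _ : ℕ => v x) atTop (𝓝 (biotSavart w x)) :=
    hsum.congr fun n => (hid n).symm
  exact tendsto_nhds_unique hconst tendsto_const_nhds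

/-! ### The pointwise Riesz-potential majorant -/

/-- The kernel of the Riesz potential of order `1` on `ℝ³` is `|x − y|⁻²`:
`ofReal (‖x − y‖^{1 − 3}) = ofReal ((‖x − y‖²)⁻¹)` (both vanish at `y = x`). [folklore] -/
private theorem ofReal_rpow_one_sub_three (x y : EuclideanSpace ℝ (Fin 3)) :
    ENNReal.ofReal (‖x - y‖ ^ ((1 : ℝ) - (Module.finrank ℝ (EuclideanSpace ℝ (Fin 3)) : ℝ))) =
      ENNReal.ofReal ((‖x - y‖ ^ 2)⁻¹) := by
  have h3 : ((1 : ℝ) - (Module.finrank ℝ (EuclideanSpace ℝ (Fin 3)) : ℝ)) = -2 := by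
    rw [finrank_euclideanSpace_fin]; norm_num
  rw [h3]
  rcases eq_or_lt_of_le (norm_nonneg (x - y)) with h | h
  · rw [← h, Real.zero_rpow (by norm_num : (-2 : ℝ) ≠ 0)]
    simp
  · congr 1
    rw [Real.rpow_neg h.le, show (2 : ℝ) = ((2 : ℕ) : ℝ) by norm_num, Real.rpow_natCast]

/-- The Riesz potential `I₁(‖ω‖ₑ)(x)` is the `lintegral` of the Biot–Savart majorant
`‖ω(y)‖ |x − y|⁻²`. [folklore] -/
private theorem rieszPotential_one_eq_lintegral (w : EuclideanSpace ℝ (Fin 3) → EuclideanSpace ℝ (Fin 3))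
    (x : EuclideanSpace ℝ (Fin 3)) :
    rieszPotential volume 1 (fun y => ‖w y‖ₑ) x =
      ∫⁻ y, ENNReal.ofReal (‖w y‖ * (‖x - y‖ ^ 2)⁻¹) := by
  rw [rieszPotential]
  refine lintegral_congr fun y => ?_
  rw [ofReal_rpow_one_sub_three, ENNReal.ofReal_mul (norm_nonneg _), ofReal_norm]

/-- **Pointwise Riesz-potential majorant of a decaying divergence-free field by its curl.** For
`v ∈ C²(ℝ³; ℝ³)` divergence free with `v → 0` at infinity and EVERY `x`:
`‖v(x)‖ ≤ (4π)⁻¹ ∫ ‖curl v(y)‖ |x − y|⁻² dy = (4π)⁻¹ I₁(‖curl v‖)(x)` in `[0, ∞]` (trivial where the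
potential is infinite; where it is finite, `v(x) = (K₃ ∗ curl v)(x)` by
`biotSavart_curl_eq_self_of_tendsto_cocompact` and `‖K₃(x − y)h‖ ≤ (4π)⁻¹‖h‖|x − y|⁻²`). This is the
pointwise form of Wu's (2.8) «`|K ∗ ω| ≤ C I₁|ω|`» for the velocity itself.
[cite: Wu2026, Lemma 2.1 proof (2.8) p.6 l.40–48] -/
theorem enorm_le_rieszPotential_curl (hv : ContDiff ℝ 2 v) (hdiv : VectorCalculus.IsDivFree v)
    (hdec : Tendsto v (cocompact (EuclideanSpace ℝ (Fin 3))) (𝓝 0)) (x : EuclideanSpace ℝ (Fin 3)) :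
    ‖v x‖ₑ ≤ ENNReal.ofReal (4 * π)⁻¹ * rieszPotential volume 1 (fun y => ‖curl v y‖ₑ) x := by
  have hπ : 0 < (4 * π)⁻¹ := by positivity
  set I : ℝ≥0∞ := rieszPotential volume 1 (fun y => ‖curl v y‖ₑ) x with hI
  by_cases htop : I = ⊤
  · rw [htop, ENNReal.mul_top (ENNReal.ofReal_pos.2 hπ).ne']
    exact le_top
  -- the majorant is integrable at `x`
  have hωc : Continuous (curl v) := continuous_curl (hv.of_le (by norm_num))
  set g : EuclideanSpace ℝ (Fin 3) → ℝ := fun y => ‖curl v y‖ * (‖x - y‖ ^ 2)⁻¹ with hgdef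
  have hg0 : ∀ y, 0 ≤ g y := fun y => by positivity
  have hgm : AEStronglyMeasurable g volume := by
    refine (hωc.norm.measurable.mul ?_).aestronglyMeasurable
    exact ((continuous_const.sub continuous_id).norm.pow 2).measurable.inv
  have hIg : I = ∫⁻ y, ENNReal.ofReal (g y) := rieszPotential_one_eq_lintegral (curl v) x
  have hint : Integrable g := by
    refine ⟨hgm, ?_⟩
    rw [hasFiniteIntegral_iff_enorm]
    have : ∫⁻ y, ‖g y‖ₑ = I := by
      rw [hIg]
      exact lintegral_congr fun y => Real.enorm_eq_ofReal (hg0 y)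
    rw [this]
    exact Ne.lt_top htop
  -- the representation and the kernel bound
  have hrep := biotSavart_curl_eq_self_of_tendsto_cocompact hv hdiv hdec hint
  have hbound : ‖v x‖ ≤ (4 * π)⁻¹ * ∫ y, g y := by
    rw [← hrep, biotSavart, ← integral_const_mul]
    refine norm_integral_le_of_norm_le (hint.const_mul _) (Eventually.of_forall fun y => ?_)
    calc ‖biotSavartKernel (x - y) (curl v y)‖ ≤ (4 * π)⁻¹ * ‖curl v y‖ * (‖x - y‖ ^ 2)⁻¹ :=
        norm_biotSavartKernel_le _ _
      _ = (4 * π)⁻¹ * g y := by rw [hgdef, mul_assoc]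
  have hIreal : ∫ y, g y = I.toReal := by
    rw [hIg, integral_eq_lintegral_of_nonneg_ae (Eventually.of_forall hg0) hgm]
  calc ‖v x‖ₑ = ENNReal.ofReal ‖v x‖ := (ofReal_norm (v x)).symm
    _ ≤ ENNReal.ofReal ((4 * π)⁻¹ * I.toReal) := by
        rw [← hIreal]; exact ENNReal.ofReal_le_ofReal hbound
    _ = ENNReal.ofReal (4 * π)⁻¹ * I := by
        rw [ENNReal.ofReal_mul hπ.le, ENNReal.ofReal_toReal htop]

/-! ### The weak-Lorentz bound: `curl v ∈ L^{p,∞} ⟹ v ∈ L^{q,∞}`, `1/q = 1/p − 1/3` -/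

/-- **Endpoint weak-Lorentz Biot–Savart bound.** Let `v ∈ C²(ℝ³; ℝ³)` be divergence free with
`v → 0` at infinity, `1 < p < 3` and `q = 3p/(3 − p)` (as real exponents of the `ℝ≥0∞` indices). If
`curl v ∈ L^{p,∞}(ℝ³)` then `v ∈ L^{q,∞}(ℝ³)`, with
`sup_t t^q |{|v| > t}| ≤ C · (sup_s s^p|{|curl v| > s}|)^{3/(3−p)} · (4π)^{−q}`, `C` the weak-HLS
constant of `meas_lt_rieszPotential_le_of_eWeakLpPow` (`α = 1`, `n = 3`): by
`enorm_le_rieszPotential_curl`, `{|v| > t} ⊆ {I₁|curl v| > 4πt}`. Wu's (2.3)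
«`‖v‖_{L^{9/2,∞}(R³)} ≤ C‖ω‖_{L^{9/5,∞}(R³)}`» is the case `p = 9/5`.
[cite: Wu2026, Lemma 2.1 (2.3) p.5 l.44–46, proof (2.8) p.6 l.40–48] [cite: Stein1971, Ch. V §1.2 Thm 1, §1.4] -/
theorem memWeakLp_of_memWeakLp_curl (hv : ContDiff ℝ 2 v) (hdiv : VectorCalculus.IsDivFree v)
    (hdec : Tendsto v (cocompact (EuclideanSpace ℝ (Fin 3))) (𝓝 0)) {p q : ℝ≥0∞}
    (hp1 : 1 < p.toReal) (hp3 : p.toReal < 3) (hq : q.toReal = 3 * p.toReal / (3 - p.toReal))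
    (hω : MemWeakLp (curl v) p volume) : MemWeakLp v q volume := by
  have hn : (Module.finrank ℝ (EuclideanSpace ℝ (Fin 3)) : ℝ) = 3 := by
    rw [finrank_euclideanSpace_fin]; norm_num
  obtain ⟨C, hC, hHLS⟩ := meas_lt_rieszPotential_le_of_eWeakLpPow (μ := volume)
    (E := EuclideanSpace ℝ (Fin 3)) (F := EuclideanSpace ℝ (Fin 3)) (α := (1 : ℝ)) (p := p) hp1 one_pos
    (by rw [hn, one_mul]; exact hp3)
  rw [hn, one_mul] at hHLS
  set P : ℝ := p.toReal with hP
  set Q : ℝ := q.toReal with hQ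
  have hP3 : 0 < 3 - P := by linarith
  have hQpos : 0 < Q := by rw [hq]; positivity
  have hQeq : 3 * P / (3 - P) = Q := hq.symm
  set W : ℝ≥0∞ := eWeakLpPow (curl v) p volume with hW
  have hWfin : W < ⊤ := hω.2
  have hωm : AEStronglyMeasurable (curl v) volume :=
    (continuous_curl (hv.of_le (by norm_num))).aestronglyMeasurable
  -- the `t`-independent bound
  set K : ℝ≥0∞ := C * W ^ ((3 : ℝ) / (3 - P)) * ENNReal.ofReal ((4 * π) ^ (-Q)) with hK
  have hKfin : K < ⊤ := by
    refine ENNReal.mul_lt_top (ENNReal.mul_lt_top hC ?_) ENNReal.ofReal_lt_top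
    exact ENNReal.rpow_lt_top_of_nonneg (by positivity) hWfin.ne
  refine ⟨hv.continuous.aestronglyMeasurable, lt_of_le_of_lt ?_ hKfin⟩
  rw [eWeakLpPow]
  refine iSup_le fun t => ?_
  by_cases ht0 : t = 0
  · -- `t = 0`: the term vanishes since `Q > 0`
    rw [ht0, ENNReal.coe_zero, ENNReal.zero_rpow_of_pos hQpos, zero_mul]
    exact bot_le
  · have ht : 0 < t := pos_iff_ne_zero.2 ht0
    have htR : 0 < (t : ℝ) := NNReal.coe_pos.2 ht
    have hπ : 0 < 4 * π := by positivity
    -- `{|v| > t} ⊆ {I₁|curl v| > 4πt}`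
    have hsub : {y : EuclideanSpace ℝ (Fin 3) | (t : ℝ≥0∞) < ‖v y‖ₑ} ⊆
        {y | ENNReal.ofReal (4 * π * t) < rieszPotential volume 1 (fun z => ‖curl v z‖ₑ) y} := by
      intro y hy
      have hle := enorm_le_rieszPotential_curl hv hdiv hdec y
      have h1 : (t : ℝ≥0∞) < ENNReal.ofReal (4 * π)⁻¹ *
          rieszPotential volume 1 (fun z => ‖curl v z‖ₑ) y := lt_of_lt_of_le hy hle
      have h2 : (t : ℝ≥0∞) / ENNReal.ofReal (4 * π)⁻¹ <
          rieszPotential volume 1 (fun z => ‖curl v z‖ₑ) y := by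
        rw [ENNReal.div_lt_iff (Or.inl (by simpa using hπ)) (Or.inl ENNReal.ofReal_ne_top)]
        rwa [mul_comm] at h1
      have h3 : (t : ℝ≥0∞) / ENNReal.ofReal (4 * π)⁻¹ = ENNReal.ofReal (4 * π * t) := by
        rw [← ENNReal.ofReal_coe_nnreal, ← ENNReal.ofReal_div_of_pos (by positivity)]
        congr 1
        field_simp
      show ENNReal.ofReal (4 * π * t) < rieszPotential volume 1 (fun z => ‖curl v z‖ₑ) y
      rwa [h3] at h2
    have hmeas := (measure_mono hsub).trans (hHLS (curl v) hωm (4 * π * t) (by positivity))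
    -- `t^Q · (4πt)^{−Q} = (4π)^{−Q}`
    have hcoe : (t : ℝ≥0∞) ^ Q = ENNReal.ofReal ((t : ℝ) ^ Q) := by
      rw [← ENNReal.ofReal_coe_nnreal, ENNReal.ofReal_rpow_of_pos htR]
    have hscal : (t : ℝ) ^ Q * (4 * π * t) ^ (-(3 * P / (3 - P))) = (4 * π) ^ (-Q) := by
      rw [hQeq, Real.mul_rpow hπ.le htR.le, Real.rpow_neg htR.le, Real.rpow_neg hπ.le]
      have htQ : (t : ℝ) ^ Q ≠ 0 := (Real.rpow_pos_of_pos htR Q).ne'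
      field_simp
    calc (t : ℝ≥0∞) ^ q.toReal * volume {y | (t : ℝ≥0∞) < ‖v y‖ₑ}
        ≤ (t : ℝ≥0∞) ^ Q * (C * W ^ ((3 : ℝ) / (3 - P)) *
            ENNReal.ofReal ((4 * π * t) ^ (-(3 * P / (3 - P))))) := mul_le_mul' le_rfl hmeas
      _ = C * W ^ ((3 : ℝ) / (3 - P)) *
            (ENNReal.ofReal ((t : ℝ) ^ Q) * ENNReal.ofReal ((4 * π * t) ^ (-(3 * P / (3 - P))))) := by
          rw [hcoe]; ring
      _ = K := by
          rw [hK, ← ENNReal.ofReal_mul (by positivity), hscal]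

/-- **Wu's (2.3): `curl v ∈ L^{9/5,∞}(ℝ³) ⟹ v ∈ L^{9/2,∞}(ℝ³)`** for `C²` divergence-free `v` vanishing
at infinity — the instance `p = 9/5`, `q = 9/2 = 3p/(3 − p)` of `memWeakLp_of_memWeakLp_curl`.
[cite: Wu2026, Lemma 2.1 (2.3) p.5 l.44–46] -/
theorem memWeakLp_nine_halves_of_memWeakLp_curl (hv : ContDiff ℝ 2 v)
    (hdiv : VectorCalculus.IsDivFree v)
    (hdec : Tendsto v (cocompact (EuclideanSpace ℝ (Fin 3))) (𝓝 0))
    (hω : MemWeakLp (curl v) ((9 : ℝ≥0∞) / 5) volume) :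
    MemWeakLp v ((9 : ℝ≥0∞) / 2) volume := by
  have h95 : ((9 : ℝ≥0∞) / 5).toReal = 9 / 5 := by
    rw [ENNReal.toReal_div]; norm_num
  have h92 : ((9 : ℝ≥0∞) / 2).toReal = 9 / 2 := by
    rw [ENNReal.toReal_div]; norm_num
  refine memWeakLp_of_memWeakLp_curl hv hdiv hdec (p := (9 : ℝ≥0∞) / 5) (q := (9 : ℝ≥0∞) / 2)
    (by rw [h95]; norm_num) (by rw [h95]; norm_num) ?_ hω
  rw [h95, h92]
  norm_num

end Main

end Literature.Analysis.FluidPDE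

end

-- WHAT THIS IS NOT: not a claim about NS regularity or blow-up; not a claim about any author beyond the typed locator.
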